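import Summits.Ventures.PercRepro.RankLevelSetUpTo3
import Summits.Ventures.PercRepro.GenQSixFourFinal
import Summits.Ventures.PercRepro.RankLevelSetFrameQM

/-!
# PercRepro — C-025 ON EVERY MATROID WITH AT MOST `10` ELEMENTS, AT EVERY `(p, q)` (night-1, gen 6)

An assembly of tree theorems, nothing new proved: a member of `U(p, q)` needs `p + q ≤ |E|` (`RLS_of_ncard_lt`), so on
a matroid with `|E| ≤ 10` only the pairs with `p + q ≤ 10` and `q + 2 ≤ p` matter — `q ≤ 3` (`C025UpTo_three`) and the
single pair `(6, 4)` (night-4's `GenQ.rls_six_four_holds_b`). The exhaustive census of the cell stops at `9` elements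
(2,198 + 383,172 classes, 0 violations); this is the kernel statement one element beyond it, for every matroid.

* **`c025_of_ncard_le_ten`** — `|E| ≤ 10 → ∀ p q, q + 2 ≤ p → RLS M p q`;
* `c025_of_ncard_le_ten'` — the literal `C025` body.
Axioms: standard.
-/

open scoped Matroid

namespace PercRepro

namespace ThmN

variable {α : Type}

/-- **C-025 on every matroid with at most `10` elements**, every pair `q + 2 ≤ p`. -/
theorem c025_of_ncard_le_ten (M : Matroid α) [M.Finite] (h10 : M.E.ncard ≤ 10) (p q : ℕ) (hqp : q + 2 ≤ p) :
    RLS M p q := by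
  classical
  rcases Nat.lt_or_ge M.E.ncard (p + q) with hlt | hge
  · exact RLS_of_ncard_lt M hlt
  · rcases Nat.lt_or_ge q 4 with hq | hq
    · exact C025UpTo_three M p q (by omega) hqp
    · have hq4 : q = 4 := by omega
      have hp : p = 6 := by omega
      subst hq4 hp
      exact GenQ.rls_six_four_holds_b M

/-- **C-025 on every matroid with at most `10` elements, the literal `C025` body.** -/
theorem c025_of_ncard_le_ten' (M : Matroid α) [M.Finite] (h10 : M.E.ncard ≤ 10) (p q : ℕ) (hqp : q + 2 ≤ p) :
    phiK p q * ({A : Set α | A ⊆ M.E ∧ M.eRk A = (p : ℕ∞) ∧ M.eRk (M.E \ A) = (q : ℕ∞)}.ncard : ℚ) ≤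
      ({A : Set α | A ⊆ M.E ∧ (q : ℕ∞) < M.eRk A ∧ M.eRk A < (p : ℕ∞)}.ncard : ℚ) :=
  c025_of_ncard_le_ten M h10 p q hqp

end ThmN

end PercRepro
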